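import Summits.ResolutionOfSingularities.ResolutionOfSingularities.Theorems.WeightedInvariantWeightedConstructionPlexComapGe
import Summits.ResolutionOfSingularities.ResolutionOfSingularities.Theorems.WeightedInvariantWeightedConstructionHullUscTight

/-!
# B2′ reduced to domination (line `pointwise-lexmax-hull`, stub `stub_plexComap`)

Route `ResolutionOfSingularities/WeightedInvariant`, crux `WeightedConstruction`
(stmt-ResolutionOfSingularities-0571), line `pointwise-lexmax-hull`. [OURS · L1 W4.3] With the ⊇-half
landed (`admissibleProfileAt_comap_of_smooth`, `LexmaxHullRule.plex_le_plex_comap`), the stub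
`stub_plexComap : ∀ p prime, ∀ R : LexmaxHullRule p, R.PlexComap` is EQUIVALENT to its content half,
DOMINATION: every profile admissible for `X.comap g` at a closed point `y₁` is bounded above by a profile
admissible for `X` at `g y₁`. This file records the reduction:

* `LexmaxHullRule.plexComap_of_dominated` — domination ⇒ `R.PlexComap`
  (`IsGreatest.eq_of_subset_of_forall_exists_le` with the landed ⊇-half).

NOT a statement of the manuscript under review; no new mathematics.
-/

noncomputable section

set_option linter.dupNamespace false -- mandated namespace of this single-conjunct summit

open CategoryTheory CategoryTheory.Limits AlgebraicGeometry TopologicalSpace IsLocalRing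
open Literature.AlgebraicGeometry.Resolution

namespace Summit.ResolutionOfSingularities.ResolutionOfSingularities.Theorems.PointwiseLexmaxHull

/-- **B2′ from domination.** If, for every smooth `k`-morphism `g : Y₁ → Y` in the regime of the rule
and every closed point `y₁` with `X` singular at `g y₁`, each profile admissible for `X.comap g` at `y₁`
is `≤` some profile admissible for `X` at `g y₁`, then `R.PlexComap` holds for every rule `R`: the
admissible set downstairs embeds into the one upstairs (`admissibleProfileAt_comap_of_smooth`, residue
field formally smooth at the closed point `g y₁`), so the greatest elements agree. [folklore] -/
theorem LexmaxHullRule.plexComap_of_dominated {p : ℕ} (R : LexmaxHullRule p)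
    (hdom : ∀ ⦃k : Type⦄ [Field k] [CharP k p] [PerfectField k] ⦃Y Y₁ : Scheme.{0}⦄
      (f : Y ⟶ Spec (.of k)) [Smooth f] [IsSeparated f] [QuasiCompact f]
      (f₁ : Y₁ ⟶ Spec (.of k)) [Smooth f₁] [IsSeparated f₁] [QuasiCompact f₁]
      (g : Y₁ ⟶ Y) [Smooth g], g ≫ f = f₁ →
      ∀ (X : Y.IdealSheafData) (y₁ : Y₁), IsClosed ({y₁} : Set Y₁) → XSing X (g y₁) →
      ∀ π : Profile, AdmissibleProfileAt (X.comap g) y₁ π →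
        ∃ π' : Profile, AdmissibleProfileAt X (g y₁) π' ∧ π ≤ π') :
    R.PlexComap := by
  intro k _ _ _ Y Y₁ f _ _ _ f₁ _ _ _ g _ hg X y₁ hy₁ hX
  haveI : JacobsonSpace Y := LocallyOfFiniteType.jacobsonSpace f
  haveI : LocallyOfFiniteType (g ≫ f) := by rw [hg]; infer_instance
  haveI : LocallyOfFiniteType g := locallyOfFiniteType_of_comp g f
  have hgy : IsClosed ({g y₁} : Set Y) := g.closePoints_subset_preimage_closedPoints hy₁
  have hX₁ : XSing (X.comap g) y₁ := (xSing_comap_iff_of_smooth f f₁ g hg X y₁).mpr hX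
  refine IsGreatest.eq_of_subset_of_forall_exists_le (s := {π | AdmissibleProfileAt X (g y₁) π})
    (t := {π | AdmissibleProfileAt (X.comap g) y₁ π}) ?_ ?_
    (R.plex_isGreatest f X (g y₁) hgy hX) (R.plex_isGreatest f₁ (X.comap g) y₁ hy₁ hX₁)
  · exact fun π hπ => admissibleProfileAt_comap_of_smooth f g X y₁
      (formallySmooth_residueField_stalk_of_isClosed f (g y₁) hgy) π hπ
  · exact fun π hπ => hdom f f₁ g hg X y₁ hy₁ hX π hπ

end Summit.ResolutionOfSingularities.ResolutionOfSingularities.Theorems.PointwiseLexmaxHull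

end
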